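import Literature.InformationTheory.QuantumCodes.TwistedToricDistance
import HarnessLib

/-!
# Toric codes on twisted tori — instances: the `L × L` torus and Kovalev–Pryadko 2013 Example 7

Topic `InformationTheory/QuantumCodes`; namespace `Literature.InformationTheory.QuantumCodes.TwistedToric`.
LADDER-QEC (cell `qec`), PARTITION row 08, item 08.TWIST (instances of `code_isCode`, `TwistedToricDistance.lean`).

* `systole_eq_of_box` — computing `sys₁(Λ)`: a nonzero period of length `d` plus «no shorter nonzero vector of the
  box `[-d,d]²` is a period» (decidable for concrete `(G, g₁, g₂)`).
* `toric_isCode` — `G = ℤ_L × ℤ_L`, `g₁ = (1,0)`, `g₂ = (0,1)` (`Λ = Lℤ²`): `[[2L², 2, L]]` for every `L ≥ 1` — the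
  untwisted toric code of Kitaev / Dennis–Kitaev–Landahl–Preskill (consistency with the tree's `ToricCodeDistance.lean`
  on a differently presented object, and Kovalev–Pryadko 2012 Ex. 2).
* (the cyclic «odd-distance rotated toric» family `[[2t²+2(t+1)², 2, 2t+1]]` of Kovalev–Pryadko 2013 Ex. 2 is the
  companion file `TwistedToricRotatedFamily.lean`, for every `t`.)
* `hb40_isCode`, `hb90_isCode` — `LP[1+xy², 1+y⁹]` over `ℤ₂×ℤ₁₀` is `[[40,2,6]]` and `LP[1+xy², 1+y¹⁴]` over `ℤ₃×ℤ₁₅` is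
  `[[90,2,9]]` — the parameters Kovalev–Pryadko 2013 Ex. 7 prints («by construction») for `(n,t) = (2,1), (3,1)`, in
  EXACTLY the presentations by which qec-lit-3's lit/TWIST-LOCATORS.md §4 identifies the venture's KERNEL-certified census
  matrices HB40 / HB90a (Tanner-graph isomorphism — a numerical identification, not a Lean theorem; the census
  certificates remain the rows' evidence). The whole Ex. 7 family `[[2n²c, 2, n(2t+1)]]` (incl. HB104's presentation
  `[[104,2,10]]`) and the cyclic family are `TwistedToricRotatedFamily.lean`.

All by `code_isCode_of_gen` + `systole_eq_of_box`; the finite checks (generation, box) are `decide`. 0 named facts.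

## References
* [KovalevPryadko2012] arXiv:1202.0928 §III.C (p0005 L52-92; Ex. 1 `[[1+(2t+1)², 2, 2t+1]]`, Ex. 2 the diagonal torus).
* [KovalevPryadko2013Hyperbicycle] arXiv:1212.6703 Ex. 2 (p0008 L11-15), Ex. 7 (p0016 L18-24).
* [DennisEtAl2002] §3.1 (chunk p0008 L5: «the code distance is d=L»).
-/

namespace Literature.InformationTheory.QuantumCodes

open Matrix Finset

namespace TwistedToric

section Box

variable {G : Type*} [AddCommGroup G] [Fintype G] {g₁ g₂ : G}

/-- **Computing the systole**: a nonzero period `m` of length `d` such that no nonzero vector of the box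
`[-d, d]²` of length `< d` is a period gives `sys₁(Λ) = d` (all shorter vectors lie in that box). For concrete
`(G, g₁, g₂)` the box condition is `decide`d. [cite: KovalevPryadko2012, §III.C (p0005 L74-77)] -/
theorem systole_eq_of_box {m : ℤ × ℤ} (hm : IsPeriod g₁ g₂ m) (h0 : m ≠ 0) {d : ℕ} (hl : l1 m = d)
    (hbox : ∀ m' ∈ Finset.Icc (-(d : ℤ)) d ×ˢ Finset.Icc (-(d : ℤ)) d, m' ≠ 0 → l1 m' < d →
      m'.1 • g₁ + m'.2 • g₂ ≠ 0) : systole g₁ g₂ = d := by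
  refine le_antisymm (hl ▸ systole_le hm h0) ?_
  obtain ⟨m', hm', h0', hl'⟩ := systole_spec g₁ g₂
  rw [← hl']
  by_contra hlt
  rw [not_le] at hlt
  refine hbox m' ?_ h0' hlt hm'
  simp only [Finset.mem_product, Finset.mem_Icc, l1] at hlt ⊢
  omega

end Box

/-! ## The untwisted `L × L` toric code -/

section Square

variable (L : ℕ) [NeZero L]

omit [NeZero L] in
/-- Periods of `(ℤ_L × ℤ_L; (1,0), (0,1))` are exactly the vectors with both coordinates divisible by `L`
(`Λ = Lℤ²`). [cite: KovalevPryadko2012, §III.C Ex. 2 (p0005 L86-92: the original toric codes)] -/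
theorem square_isPeriod_iff (m : ℤ × ℤ) :
    IsPeriod ((1, 0) : ZMod L × ZMod L) (0, 1) m ↔ (L : ℤ) ∣ m.1 ∧ (L : ℤ) ∣ m.2 := by
  simp only [IsPeriod, Prod.smul_mk, smul_zero, zsmul_eq_mul, mul_one, Prod.mk_add_mk, add_zero, zero_add,
    Prod.mk_eq_zero, ZMod.intCast_zmod_eq_zero_iff_dvd]

/-- **The `L × L` toric code is `[[2L², 2, L]]`** in the twisted-torus presentation `(ℤ_L × ℤ_L; (1,0), (0,1))`,
for every `L ≥ 1`. [cite: DennisEtAl2002, §3.1 (chunk p0008 L5: «the code distance is d=L»)] [cite: KovalevPryadko2012, §III.C Ex. 2 (p0005 L86-92: n = 2L_ξL_η, k = 2, d = min(L_ξ, L_η))] -/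
theorem toric_isCode : (code ((1, 0) : ZMod L × ZMod L) (0, 1)).IsCode (2 * (L * L)) 2 L := by
  have hgen : ∀ x : ZMod L × ZMod L, ∃ m : ℤ × ℤ, m.1 • ((1, 0) : ZMod L × ZMod L) + m.2 • (0, 1) = x := by
    intro x
    refine ⟨((x.1.val : ℤ), (x.2.val : ℤ)), ?_⟩
    ext <;> simp
  have hsys : systole ((1, 0) : ZMod L × ZMod L) (0, 1) = L := by
    refine le_antisymm ?_ ?_
    · have h := systole_le (g₁ := ((1, 0) : ZMod L × ZMod L)) (g₂ := (0, 1)) (m := ((L : ℤ), 0))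
        ((square_isPeriod_iff L _).2 ⟨dvd_rfl, dvd_zero _⟩) (by simp [Prod.ext_iff, NeZero.ne L])
      simpa [l1] using h
    · obtain ⟨m, hm, h0, hl⟩ := systole_spec ((1, 0) : ZMod L × ZMod L) (0, 1)
      rw [← hl]
      obtain ⟨⟨a, ha⟩, ⟨b, hb⟩⟩ := (square_isPeriod_iff L m).1 hm
      have : a ≠ 0 ∨ b ≠ 0 := by
        by_contra h; rw [not_or, not_not, not_not] at h
        apply h0; ext <;> simp [ha, hb, h.1, h.2]
      simp only [l1, ha, hb, Int.natAbs_mul, Int.natAbs_natCast]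
      rcases this with h | h
      · have h1 : 1 ≤ a.natAbs := Int.natAbs_pos.2 h
        have h2 := Nat.mul_le_mul_left L h1
        omega
      · have h1 : 1 ≤ b.natAbs := Int.natAbs_pos.2 h
        have h2 := Nat.mul_le_mul_left L h1
        omega
  have h := code_isCode_of_gen hgen
  rwa [hsys, Fintype.card_prod, ZMod.card] at h

end Square

/-! ## Kovalev–Pryadko 2013 Example 7: `[[40,2,6]]`, `[[90,2,9]]` in qec-lit-3's census presentations -/

section HB

/-- **`[[40, 2, 6]]`**: `LP[1 + x y², 1 + y⁹]` over `ℤ₂ × ℤ₁₀` (`g₁ = (1,2)`, `g₂ = (0,9)`; `sys₁ = 6` attained by `(2,4)`) —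
the `(n,t) = (2,1)` member of KP13 Ex. 7, identified with census row HB40 by qec-lit-3 (Tanner-graph isomorphism).
[cite: KovalevPryadko2013Hyperbicycle, §IV Ex. 7 (p0016 L18-24: «for n=2 we obtain [[40,2,6]]»)] -/
theorem hb40_isCode : (code ((1, 2) : ZMod 2 × ZMod 10) (0, 9)).IsCode 40 2 6 := by
  have hgen : ∀ x : ZMod 2 × ZMod 10, ∃ m : ℤ × ℤ, m.1 • ((1, 2) : ZMod 2 × ZMod 10) + m.2 • (0, 9) = x := by
    have h : ∀ x : ZMod 2 × ZMod 10, ∃ m ∈ Finset.Icc (0 : ℤ) 1 ×ˢ Finset.Icc (0 : ℤ) 9,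
        m.1 • ((1, 2) : ZMod 2 × ZMod 10) + m.2 • (0, 9) = x := by decide +kernel
    intro x; obtain ⟨m, -, hm⟩ := h x; exact ⟨m, hm⟩
  have hsys : systole ((1, 2) : ZMod 2 × ZMod 10) (0, 9) = 6 :=
    systole_eq_of_box (m := (2, 4)) (by unfold IsPeriod; decide) (by decide) rfl (by decide +kernel)
  have h := code_isCode_of_gen hgen
  rwa [hsys, Fintype.card_prod, ZMod.card, ZMod.card] at h

/-- **`[[90, 2, 9]]`**: `LP[1 + x y², 1 + y¹⁴]` over `ℤ₃ × ℤ₁₅` (`g₁ = (1,2)`, `g₂ = (0,14)`; `sys₁ = 9` attained by `(3,6)`) —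
the `(n,t) = (3,1)` member of KP13 Ex. 7, identified with census row HB90a (FINDINGS CR-5) by qec-lit-3.
[cite: KovalevPryadko2013Hyperbicycle, §IV Ex. 7 (p0016 L18-24: «for n=3 [[90,2,9]]»)] -/
theorem hb90_isCode : (code ((1, 2) : ZMod 3 × ZMod 15) (0, 14)).IsCode 90 2 9 := by
  have hgen : ∀ x : ZMod 3 × ZMod 15, ∃ m : ℤ × ℤ, m.1 • ((1, 2) : ZMod 3 × ZMod 15) + m.2 • (0, 14) = x := by
    have h : ∀ x : ZMod 3 × ZMod 15, ∃ m ∈ Finset.Icc (0 : ℤ) 2 ×ˢ Finset.Icc (0 : ℤ) 14,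
        m.1 • ((1, 2) : ZMod 3 × ZMod 15) + m.2 • (0, 14) = x := by decide +kernel
    intro x; obtain ⟨m, -, hm⟩ := h x; exact ⟨m, hm⟩
  have hsys : systole ((1, 2) : ZMod 3 × ZMod 15) (0, 14) = 9 :=
    systole_eq_of_box (m := (3, 6)) (by unfold IsPeriod; decide) (by decide) rfl (by decide +kernel)
  have h := code_isCode_of_gen hgen
  rwa [hsys, Fintype.card_prod, ZMod.card, ZMod.card] at h

end HB

/-! ## Rectangular tori `L₁ × L₂` (Kovalev–Pryadko 2012 Ex. 2: the original toric codes, `d = min(L_ξ, L_η)`) -/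

section Rect

variable (L₁ L₂ : ℕ) [NeZero L₁] [NeZero L₂]

omit [NeZero L₁] [NeZero L₂] in
/-- Periods of `(ℤ_{L₁} × ℤ_{L₂}; (1,0), (0,1))` are the vectors with `L₁ ∣ m₁` and `L₂ ∣ m₂` (`Λ = L₁ℤ × L₂ℤ`).
[cite: KovalevPryadko2012, §III.C Ex. 2 (p0005 L86-92: L₁ = (L_ξ, L_ξ), L₂ = (−L_η, L_η) — the original toric codes)] -/
theorem rect_isPeriod_iff (m : ℤ × ℤ) :
    IsPeriod ((1, 0) : ZMod L₁ × ZMod L₂) (0, 1) m ↔ (L₁ : ℤ) ∣ m.1 ∧ (L₂ : ℤ) ∣ m.2 := by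
  simp only [IsPeriod, Prod.smul_mk, smul_zero, zsmul_eq_mul, mul_one, Prod.mk_add_mk, add_zero, zero_add,
    Prod.mk_eq_zero, ZMod.intCast_zmod_eq_zero_iff_dvd]

/-- **The rectangular `L₁ × L₂` toric code is `[[2L₁L₂, 2, min(L₁, L₂)]]`** (twisted-torus presentation
`(ℤ_{L₁} × ℤ_{L₂}; (1,0), (0,1))`, `Λ = L₁ℤ × L₂ℤ`, `sys₁ = min(L₁, L₂)`), for all `L₁, L₂ ≥ 1`.
[cite: KovalevPryadko2012, §III.C Ex. 2 (p0005 L86-92: «n = 2L_ξL_η, k = 2, and d = min(L_ξ, L_η)»)] -/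
theorem toricRect_isCode : (code ((1, 0) : ZMod L₁ × ZMod L₂) (0, 1)).IsCode (2 * (L₁ * L₂)) 2 (min L₁ L₂) := by
  have hgen : ∀ x : ZMod L₁ × ZMod L₂, ∃ m : ℤ × ℤ, m.1 • ((1, 0) : ZMod L₁ × ZMod L₂) + m.2 • (0, 1) = x := by
    intro x
    refine ⟨((x.1.val : ℤ), (x.2.val : ℤ)), ?_⟩
    ext <;> simp
  have hsys : systole ((1, 0) : ZMod L₁ × ZMod L₂) (0, 1) = min L₁ L₂ := by
    refine le_antisymm ?_ ?_
    · rcases le_total L₁ L₂ with h | h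
      · have hp := systole_le (g₁ := ((1, 0) : ZMod L₁ × ZMod L₂)) (g₂ := (0, 1)) (m := ((L₁ : ℤ), 0))
          ((rect_isPeriod_iff L₁ L₂ _).2 ⟨dvd_rfl, dvd_zero _⟩) (by simp [Prod.ext_iff, NeZero.ne L₁])
        rw [min_eq_left h]; simpa [l1] using hp
      · have hp := systole_le (g₁ := ((1, 0) : ZMod L₁ × ZMod L₂)) (g₂ := (0, 1)) (m := (0, (L₂ : ℤ)))
          ((rect_isPeriod_iff L₁ L₂ _).2 ⟨dvd_zero _, dvd_rfl⟩) (by simp [Prod.ext_iff, NeZero.ne L₂])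
        rw [min_eq_right h]; simpa [l1] using hp
    · obtain ⟨m, hm, h0, hl⟩ := systole_spec ((1, 0) : ZMod L₁ × ZMod L₂) (0, 1)
      rw [← hl]
      obtain ⟨⟨a, ha⟩, ⟨b, hb⟩⟩ := (rect_isPeriod_iff L₁ L₂ m).1 hm
      have : a ≠ 0 ∨ b ≠ 0 := by
        by_contra h; rw [not_or, not_not, not_not] at h
        apply h0; ext <;> simp [ha, hb, h.1, h.2]
      simp only [l1, ha, hb, Int.natAbs_mul, Int.natAbs_natCast]
      rcases this with h | h
      · have h1 : 1 ≤ a.natAbs := Int.natAbs_pos.2 h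
        have h2 := Nat.mul_le_mul_left L₁ h1
        have h3 := min_le_left L₁ L₂
        omega
      · have h1 : 1 ≤ b.natAbs := Int.natAbs_pos.2 h
        have h2 := Nat.mul_le_mul_left L₂ h1
        have h3 := min_le_right L₁ L₂
        omega
  have h := code_isCode_of_gen hgen
  rwa [hsys, Fintype.card_prod, ZMod.card, ZMod.card] at h

end Rect

end TwistedToric

end Literature.InformationTheory.QuantumCodes
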